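import Literature.RingTheory.PBasis.KimuraNiitsuma1980
import Mathlib.RingTheory.Derivation.Basic
import HarnessLib

/-!
# Route `RadicialJung`, crux `CleanModels` (stmt-15917): a dual derivation of a `p`-basis acts
# diagonally on the monomial expansion (Giraud 1983 §2.6, input (L1) of `K2-DESIGN.md` §5.6/5.7)

Support file (OURS; general algebra in characteristic `p`) for PROGRAMME-clean-dim2 (K2 step 2.6,
W8.1). In Giraud's proof of Lemme 2.3 (iii) (Bull. SMF 111 (1983), 2.6, pp. 119–120) the partial
derivatives `f′_x, f′_y, f′_{uᵢ}` along the differential coordinates act on the expansion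
`f = Σ f_{ijb}^p xⁱ yʲ u^b` (§1.4 (2)) termwise: `x f′_x = Σ i · f_{ijb}^p xⁱ yʲ u^b`, etc. Here, for any
ring `R` of characteristic `p`, a `p`-basis `Γ` of `R` over `R^p` in Kimura–Niitsuma's sense
(`IsPBasisOver`, `RadicialJungCleanModelsPBasisMonomials.lean`) and ANY derivation `D : R → R`
dual to `γ₀ ∈ Γ` (`D γ₀ = 1`, `D γ = 0` for `γ ≠ γ₀` in `Γ`; how `D` is constructed — from a free
module of differentials, or otherwise — is irrelevant here):

* `derivation_pow_char` — `D(a^p) = 0`, hence `D(a^p · m) = a^p · D m` (`derivation_frobenius_mul`);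
* `mul_derivation_monomial` — **`γ₀ · D(Γ^b) = (b γ₀) · Γ^b`** for every reduced monomial;
* `mul_derivation_expansion` — **`γ₀ · D(Σ_b c_b Γ^b) = Σ_b (b γ₀) · c_b Γ^b`** for coefficients
  `c_b ∈ R^p`: the operator `γ₀ D` is diagonal in the monomial basis with eigenvalues
  `b γ₀ ∈ {0, …, p−1}`.

References: J. Giraud, Bull. SMF 111 (1983), 1.4, 2.6 [Giraud1983]; T. Kimura, H. Niitsuma (1980)
[KimuraNiitsuma1980]. Nothing here is a statement of Hironaka's manuscript or bears on the summit
directly.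
-/

noncomputable section

set_option linter.dupNamespace false -- mandated namespace of this single-conjunct summit

open Literature.RingTheory.PBasis

namespace Summit.ResolutionOfSingularities.ResolutionOfSingularities.Theorems.RadicialJung.CleanModels

universe u

variable {p : ℕ} [Fact p.Prime] {R : Type u} [CommRing R] [CharP R p]

omit [Fact p.Prime] in
/-- In characteristic `p` every derivation kills `p`-th powers: `D(a^p) = p a^{p-1} Da = 0`.
[folklore] -/
theorem derivation_pow_char (D : Derivation ℤ R R) (a : R) : D (a ^ p) = 0 := by
  rw [D.leibniz_pow, smul_eq_mul, nsmul_eq_mul, CharP.cast_eq_zero R p, zero_mul]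

/-- Hence `D(c · m) = c · D m` for `c ∈ R^p` (the range of Frobenius). [folklore] -/
theorem derivation_frobenius_mul (D : Derivation ℤ R R) (c : (frobenius R p).range) (m : R) :
    D ((c : R) * m) = (c : R) * D m := by
  obtain ⟨a, ha⟩ := c.2
  rw [D.leibniz, smul_eq_mul, smul_eq_mul, ← ha, frobenius_def, derivation_pow_char D a, mul_zero,
    add_zero]

/-- A derivation killing `v i` for all `i ∈ s` kills `∏_{i ∈ s} (v i)^{n i}`. [folklore] -/
theorem derivation_prod_pow_eq_zero {ι : Type*} (D : Derivation ℤ R R) (v : ι → R) (n : ι → ℕ)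
    (s : Finset ι) (hD : ∀ i ∈ s, D (v i) = 0) : D (∏ i ∈ s, v i ^ n i) = 0 := by
  classical
  induction s using Finset.induction_on with
  | empty => simp
  | insert i s hi ih =>
    rw [Finset.prod_insert hi, D.leibniz, smul_eq_mul, smul_eq_mul,
      ih (fun j hj => hD j (Finset.mem_insert_of_mem hj)), D.leibniz_pow,
      hD i (Finset.mem_insert_self i s), smul_zero, smul_zero, mul_zero, mul_zero, add_zero]

/-- The same for a finitely supported exponent vector (`Finsupp.prod`). [folklore] -/
theorem derivation_finsupp_prod_eq_zero {ι : Type*} (D : Derivation ℤ R R) (v : ι → R)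
    (b : ι →₀ ℕ) (hD : ∀ i ∈ b.support, D (v i) = 0) :
    D (b.prod fun i n => v i ^ n) = 0 :=
  derivation_prod_pow_eq_zero D v b b.support hD

/-- **`γ₀ · D(Γ^b) = (b γ₀) · Γ^b`** for a derivation `D` dual to `γ₀ ∈ Γ` (`D γ₀ = 1`, `D γ = 0`
for the other `γ ∈ Γ`) and a monomial `Γ^b = ∏ γ^{b γ}` (`b : Γ →₀ ℕ`): `Γ^b = γ₀^k · (rest)` with
`D(rest) = 0` and `γ₀ · D(γ₀^k) = k γ₀^k`. [cite: Giraud1983, 2.6] -/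
theorem mul_derivation_monomial {Γ : Set R} (D : Derivation ℤ R R) (γ₀ : Γ) (hD₀ : D (γ₀ : R) = 1)
    (hD : ∀ γ : Γ, γ ≠ γ₀ → D (γ : R) = 0) (b : Γ →₀ ℕ) :
    (γ₀ : R) * D (b.prod fun γ n => ((γ : Γ) : R) ^ n) =
      (b γ₀ : R) * b.prod fun γ n => ((γ : Γ) : R) ^ n := by
  classical
  by_cases hγ₀ : γ₀ ∈ b.support
  · -- `Γ^b = γ₀^k * rest`
    have hsplit : (b.prod fun γ n => ((γ : Γ) : R) ^ n) =
        ((γ₀ : Γ) : R) ^ (b γ₀) * (b.erase γ₀).prod fun γ n => ((γ : Γ) : R) ^ n :=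
      (Finsupp.mul_prod_erase b γ₀ (fun γ n => ((γ : Γ) : R) ^ n) hγ₀).symm
    have hrest : D ((b.erase γ₀).prod fun γ n => ((γ : Γ) : R) ^ n) = 0 := by
      refine derivation_finsupp_prod_eq_zero D (fun γ : Γ => ((γ : Γ) : R)) (b.erase γ₀) ?_
      intro γ hγ
      have hne : γ ≠ γ₀ := by
        rintro rfl
        rw [Finsupp.support_erase, Finset.mem_erase] at hγ
        exact hγ.1 rfl
      exact hD γ hne
    obtain ⟨k, hk⟩ : ∃ k, b γ₀ = k + 1 := Nat.exists_eq_add_one_of_ne_zero (Finsupp.mem_support_iff.mp hγ₀)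
    rw [hsplit, D.leibniz, hrest, smul_zero, zero_add, smul_eq_mul, D.leibniz_pow, hD₀, smul_eq_mul,
      mul_one, nsmul_eq_mul, hk, Nat.add_sub_cancel]
    push_cast
    ring
  · -- `γ₀ ∉ supp b`: both sides vanish
    have h0 : b γ₀ = 0 := Finsupp.notMem_support_iff.mp hγ₀
    rw [h0, Nat.cast_zero, zero_mul, derivation_finsupp_prod_eq_zero D (fun γ : Γ => ((γ : Γ) : R)) b
      (fun γ hγ => hD γ (by rintro rfl; exact hγ₀ hγ)), mul_zero]

/-- **The operator `γ₀ · D` is diagonal on `p`-basis expansions**: for coefficients `c_b ∈ R^p`,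
`γ₀ · D(Σ_b c_b Γ^b) = Σ_b (b γ₀) · c_b · Γ^b` (Giraud 1983, 2.6: the derivatives of
`f = Σ f_{ijb}^p xⁱyʲu^b` are computed termwise, `D(a^p) = 0`). [cite: Giraud1983, 2.6] -/
theorem mul_derivation_expansion {Γ : Set R} (D : Derivation ℤ R R) (γ₀ : Γ) (hD₀ : D (γ₀ : R) = 1)
    (hD : ∀ γ : Γ, γ ≠ γ₀ → D (γ : R) = 0) {ι : Type*} (e : ι → (Γ →₀ ℕ))
    (c : ι →₀ (frobenius R p).range) :
    (γ₀ : R) * D (c.sum fun i r => (r : R) * (e i).prod fun γ n => ((γ : Γ) : R) ^ n) =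
      c.sum fun i r => ((e i) γ₀ : R) * ((r : R) * (e i).prod fun γ n => ((γ : Γ) : R) ^ n) := by
  classical
  unfold Finsupp.sum
  rw [map_sum, Finset.mul_sum]
  refine Finset.sum_congr rfl fun i _ => ?_
  rw [derivation_frobenius_mul, mul_left_comm, mul_derivation_monomial D γ₀ hD₀ hD (e i)]
  ring

end Summit.ResolutionOfSingularities.ResolutionOfSingularities.Theorems.RadicialJung.CleanModels

end
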